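import Summits.QuantumFields.YangMills.Theorems.ColdStartUniversalityLatticeLangevinHypercontractiveColdStart
import Summits.QuantumFields.YangMills.Theorems.ColdStartUniversalityLatticeLangevinErgodicAverage
import Summits.QuantumFields.YangMills.Theorems.ColdStartUniversalityLatticeLangevinMarkovProperty
import HarnessLib

/-!
# Route `ColdStartUniversality` (fixed-cut-off package, `Lᵖ` side): ★★★ VOLUME-FREE TIME DECORRELATION AND MEAN-SQUARE ERGODIC THEOREM
# for ALL bounded observables after an `O(log L)` burn-in, `|β'| < 1/12` — the `L²`-WARM START delivered by hypercontractivity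

Helper file (seat `ym-line-csu-p1`, g36; `--supports stmt-QuantumFields-24809`).  SU(2) lattice Langevin dynamics of Shen–Zhu–Zhu at
`(L, β')`, Wilson measure `μ = μ_{β'}`, THE realising kernel family `κ`, strong solutions `U` from a deterministic start on ANY space.
g33's decorrelation / mean-square ergodic theorem (`abs_twoTime_centered_le_exp`, `integral_sq_timeAverage_sub_wilson_le`) hold for every
bounded observable with HARRIS constants `C, c` depending on `L, β'` (volume-free only for LOCAL `C⁵` observables, g29/g30).  In the window
`|β'| < 1/12` hypercontractivity gives, for ALL bounded measurable observables, volume-free constants after a burn-in `a₀ = 2 + t₀`,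
`t₀ = log B/(2(1 − 12|β'|)) = O(log L)` (`B = 96|β'|#E + 10|β'|#𝒫 + log 2 + #E·log(3/2)` the explicit log-density bound of g27):

* ★★ `abs_integral_transition_le_exp_mul_of_warm` — the `L²`-WARM START (conditional form, LSI(`ρ`) as hypothesis): for a probability
  measure `ν ≤ D·μ` (`D ≥ e`) and `log log D ≤ 4ρt₀`, EVERY bounded measurable `φ` and every `u ≥ 0` satisfy
  `|∫ κ_{t₀+u} φ dν| ≤ e · (∫ φ² dμ)^{1/2}` (the law `νκ_{t₀+u}` has an `L²(μ)`-density of norm `≤ e`, in dual form);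
* ★★★ `abs_twoTime_centered_le_exp_uniform` — for `|β'| < 1/12`, every solution from a deterministic start, all bounded measurable `F`
  (`|F| ≤ 1`), `G`, all lattice times `u, t ≥ 0`:
  `|E[F(U_{2+t₀+u})·(G(U_{2+t₀+u+t}) − μG)]| ≤ e · e^{−(1−12|β'|)t} · (∫ (G − μG)² dμ)^{1/2}` — rate AND prefactor independent of `L`;
* ★★★ `integral_sq_timeAverage_sub_wilson_le_uniform` — VOLUME-FREE MEAN-SQUARE ERGODIC THEOREM after the burn-in: for jointly measurable
  solutions, `|G| ≤ 1`, `T > 0`:  `E[(T⁻¹∫_{(0,T]} G(U_{2+t₀+r}) dr − μG)²] ≤ 8e/((1 − 12|β'|)·T)`.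

THEOREMS ONLY, no definition, no sorry.  HONEST FRAMING: RECORD-rung R3 plumbing at FIXED cut-off in LATTICE units; "volume-free" refers
to `L` at fixed `|β'| < 1/12` (high temperature), the burn-in is `O(log L)`; the route's scaling `β'_K → ∞` leaves the window; nothing
K-uniform is proved; no crux, rung or summit statement is proved; the Yang–Mills mass gap is NOT proved.
-/

set_option autoImplicit false

noncomputable section

namespace Summit.QuantumFields.YangMills.Theorems.ColdStartUniversality

open MeasureTheory ProbabilityTheory Filter Set Topology
open scoped BigOperators NNReal ENNReal
open Literature.Probability.Process Literature.MathematicalPhysics.QuantumFieldTheory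
open Literature.MathematicalPhysics.QuantumLattice (fundamentalRep fundamentalLatticeRep continuous_fundamentalRep)

variable {L : ℕ} [NeZero L]

/-! ## §1. The `L²`-warm start after the hypercontractive burn-in -/

/-- ★★ **`L²`-warm start (dual form).**  Under the generator-form log-Sobolev inequality with constant `ρ ≥ 0`: if `ν ≤ D·μ_{β'}` is a
probability measure with `D ≥ e` and `log log D ≤ 4ρ·t₀`, then for every bounded measurable `φ` and every `u ≥ 0`,
`|∫ κ_{t₀+u} φ dν| ≤ e · (∫ φ² dμ_{β'})^{1/2}` (Jensen against `ν ≤ D·μ` in `L^q`, `q = 1 + e^{4ρ(t₀+u)} ≥ 1 + log D`, hypercontractivity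
`‖κ_{t₀+u}‖_{2→q} ≤ 1`, `D^{1/q} ≤ e`). [cite: DiaconisSaloffcoste1996, Theorem 3.7] -/
theorem abs_integral_transition_le_exp_mul_of_warm (L : ℕ) [NeZero L] (β' : ℝ)
    (κ : ℝ≥0 → Kernel (GaugeConfig 3 L (Matrix.specialUnitaryGroup (Fin 2) ℂ))
      (GaugeConfig 3 L (Matrix.specialUnitaryGroup (Fin 2) ℂ))) [∀ t, IsMarkovKernel (κ t)]
    (hreal : ∀ (t : ℝ≥0) (x : GaugeConfig 3 L (Matrix.specialUnitaryGroup (Fin 2) ℂ))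
        (Ω : Type) [MeasurableSpace Ω] (P : Measure Ω) [IsProbabilityMeasure P]
        (W : ℝ≥0 → Ω → (Edge 3 L × NoiseIdx 2 → ℝ)) (hW : IsFlatBrownian W P)
        (U : ℝ≥0 → Ω → GaugeConfig 3 L (Matrix.specialUnitaryGroup (Fin 2) ℂ)),
        (∀ ω, U 0 ω = x) →
        (latticeLangevinDynamics (fundamentalLatticeRep 2) β').IsSolution (fundamentalRep (Fin 2))
          hW.natFiltration P W U →
        κ t x = P.map (U t))
    {ρ : ℝ} (hρ : 0 ≤ ρ)
    (hLSgen : ∀ (f : (Edge 3 L × Fin 2 × Fin 2 × Bool → ℝ) → ℝ), ContDiff ℝ 3 f →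
        let coords : GaugeConfig 3 L (Matrix.specialUnitaryGroup (Fin 2) ℂ) → (Edge 3 L × Fin 2 × Fin 2 × Bool → ℝ) :=
          fun V q => (fun z : ℂ => if q.2.2.2 then z.im else z.re)
            ((fundamentalRep (Fin 2) (V q.1) : Matrix (Fin 2) (Fin 2) ℂ) q.2.1 q.2.2.1)
        let gen : GaugeConfig 3 L (Matrix.specialUnitaryGroup (Fin 2) ℂ) → ℝ := fun V =>
          (∑ i : Edge 3 L × Fin 2 × Fin 2 × Bool, fderiv ℝ f (coords V) (Pi.single i 1) *
              (fun z : ℂ => if i.2.2.2 then z.im else z.re)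
                ((latticeLangevinDynamics (fundamentalLatticeRep 2) β').drift
                  (matrixConfig (fundamentalRep (Fin 2)) V) i.1 i.2.1 i.2.2.1) +
          1 / 2 * ∑ i : Edge 3 L × Fin 2 × Fin 2 × Bool, ∑ j : Edge 3 L × Fin 2 × Fin 2 × Bool,
            fderiv ℝ (fun z => fderiv ℝ f z (Pi.single i 1)) (coords V) (Pi.single j 1) *
              ∑ n : Edge 3 L × NoiseIdx 2,
                (if n.1 = i.1 then (fun z : ℂ => if i.2.2.2 then z.im else z.re)
                  ((latticeLangevinDynamics (fundamentalLatticeRep 2) β').noise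
                    (matrixConfig (fundamentalRep (Fin 2)) V) i.1 n.2 i.2.1 i.2.2.1) else 0) *
                (if n.1 = j.1 then (fun z : ℂ => if j.2.2.2 then z.im else z.re)
                  ((latticeLangevinDynamics (fundamentalLatticeRep 2) β').noise
                    (matrixConfig (fundamentalRep (Fin 2)) V) j.1 n.2 j.2.1 j.2.2.1) else 0))
        ρ * ((∫ V, f (coords V) ^ 2 * Real.log (f (coords V) ^ 2) ∂(wilsonMeasure (d := 3) (L := L) (fundamentalRep (Fin 2)) β')) -
            (∫ V, f (coords V) ^ 2 ∂(wilsonMeasure (d := 3) (L := L) (fundamentalRep (Fin 2)) β')) *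
              Real.log (∫ V, f (coords V) ^ 2 ∂(wilsonMeasure (d := 3) (L := L) (fundamentalRep (Fin 2)) β'))) ≤
          -∫ V, f (coords V) * gen V ∂(wilsonMeasure (d := 3) (L := L) (fundamentalRep (Fin 2)) β'))
    {ν : Measure (GaugeConfig 3 L (Matrix.specialUnitaryGroup (Fin 2) ℂ))} [IsProbabilityMeasure ν] {D : ℝ} (hDe : Real.exp 1 ≤ D)
    (hν : ν ≤ (ENNReal.ofReal D) • wilsonMeasure (d := 3) (L := L) (fundamentalRep (Fin 2)) β')
    {t₀ : ℝ≥0} (ht₀ : Real.log (Real.log D) ≤ 4 * ρ * t₀)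
    {φ : GaugeConfig 3 L (Matrix.specialUnitaryGroup (Fin 2) ℂ) → ℝ} (hφ : Measurable φ) {M : ℝ} (hM : ∀ x, |φ x| ≤ M)
    (u : ℝ≥0) :
    |∫ x, (∫ y, φ y ∂(κ (t₀ + u) x)) ∂ν| ≤
      Real.exp 1 * (∫ x, |φ x| ^ (2 : ℝ) ∂(wilsonMeasure (d := 3) (L := L) (fundamentalRep (Fin 2)) β')) ^ (1 / (2 : ℝ)) := by
  classical
  haveI := secondCountableTopology_su2
  haveI := borelSpace_config L
  set μ : Measure (GaugeConfig 3 L (Matrix.specialUnitaryGroup (Fin 2) ℂ)) :=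
    wilsonMeasure (d := 3) (L := L) (fundamentalRep (Fin 2)) β' with hμ
  haveI : IsProbabilityMeasure μ :=
    isProbabilityMeasure_wilsonMeasure (d := 3) (L := L) (fundamentalRep (Fin 2)) (continuous_fundamentalRep (Fin 2)) β'
  have hD1 : 1 ≤ D := le_trans (by have := Real.add_one_le_exp (1 : ℝ); linarith) hDe
  have hD0 : 0 ≤ D := by linarith
  set q : ℝ := 1 + Real.exp (4 * ρ * ((t₀ + u : ℝ≥0) : ℝ)) with hq
  have hq1 : 1 < q := by have := Real.exp_pos (4 * ρ * ((t₀ + u : ℝ≥0) : ℝ)); rw [hq]; linarith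
  have hq0 : 0 < q := by linarith
  -- `log D ≤ q`
  have hlogq : Real.log D ≤ q := by
    have hlogpos : 0 < Real.log D := by
      have := Real.log_le_log (Real.exp_pos 1) hDe
      rw [Real.log_exp] at this; linarith
    have h1 : Real.log (Real.log D) ≤ 4 * ρ * ((t₀ + u : ℝ≥0) : ℝ) := by
      have : (0 : ℝ) ≤ 4 * ρ * (u : ℝ) := by positivity
      push_cast; linarith
    have h2 : Real.log D ≤ Real.exp (4 * ρ * ((t₀ + u : ℝ≥0) : ℝ)) := by
      calc Real.log D = Real.exp (Real.log (Real.log D)) := (Real.exp_log hlogpos).symm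
        _ ≤ _ := Real.exp_le_exp.2 h1
    rw [hq]; linarith
  -- Jensen against `ν ≤ D μ`
  have hKm : Measurable fun x => ∫ y, φ y ∂(κ (t₀ + u) x) := (hφ.stronglyMeasurable.integral_kernel (κ := κ (t₀ + u))).measurable
  have hKb : ∀ x, |∫ y, φ y ∂(κ (t₀ + u) x)| ≤ M := fun x => abs_integral_le_of_abs_le_of_isProbabilityMeasure (μ := κ (t₀ + u) x) hM
  have hJ : |∫ x, (∫ y, φ y ∂(κ (t₀ + u) x)) ∂ν| ^ q ≤ D * ∫ x, |∫ y, φ y ∂(κ (t₀ + u) x)| ^ q ∂μ := by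
    have h1 : |∫ x, (∫ y, φ y ∂(κ (t₀ + u) x)) ∂ν| ≤ ∫ x, |∫ y, φ y ∂(κ (t₀ + u) x)| ∂ν := abs_integral_le_integral_abs
    exact (Real.rpow_le_rpow (abs_nonneg _) h1 hq0.le).trans (rpow_integral_abs_le_mul_integral_of_le_smul hD0 hν hKm hKb hq1.le)
  -- hypercontractivity `2 → q` over the time `t₀ + u`
  have hHC := lqNorm_transition_le_of_generatorLogSobolev_of_measurable L β' κ hreal hρ hLSgen hφ hM (p := 2) (by norm_num) (t₀ + u)
  have eq2 : 1 + ((2 : ℝ) - 1) * Real.exp (4 * ρ * ((t₀ + u : ℝ≥0) : ℝ)) = q := by rw [hq]; ring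
  rw [eq2] at hHC
  have hI0 : 0 ≤ ∫ x, |∫ y, φ y ∂(κ (t₀ + u) x)| ^ q ∂μ := integral_nonneg fun x => Real.rpow_nonneg (abs_nonneg _) q
  have hstep1 : |∫ x, (∫ y, φ y ∂(κ (t₀ + u) x)) ∂ν| ≤ (D * ∫ x, |∫ y, φ y ∂(κ (t₀ + u) x)| ^ q ∂μ) ^ (1 / q) := by
    have h := Real.rpow_le_rpow (Real.rpow_nonneg (abs_nonneg _) q) hJ (by positivity : (0 : ℝ) ≤ 1 / q)
    rwa [← Real.rpow_mul (abs_nonneg _), mul_one_div_cancel hq0.ne', Real.rpow_one] at h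
  have hDq : D ^ (1 / q) ≤ Real.exp 1 := rpow_one_div_le_exp_of_log_le hDe hlogq
  have hN2 : 0 ≤ (∫ x, |φ x| ^ (2 : ℝ) ∂μ) ^ (1 / (2 : ℝ)) := Real.rpow_nonneg (integral_nonneg fun x => Real.rpow_nonneg (abs_nonneg _) _) _
  calc |∫ x, (∫ y, φ y ∂(κ (t₀ + u) x)) ∂ν| ≤ (D * ∫ x, |∫ y, φ y ∂(κ (t₀ + u) x)| ^ q ∂μ) ^ (1 / q) := hstep1
    _ = D ^ (1 / q) * (∫ x, |∫ y, φ y ∂(κ (t₀ + u) x)| ^ q ∂μ) ^ (1 / q) := Real.mul_rpow hD0 hI0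
    _ ≤ D ^ (1 / q) * (∫ x, |φ x| ^ (2 : ℝ) ∂μ) ^ (1 / (2 : ℝ)) := mul_le_mul_of_nonneg_left hHC (Real.rpow_nonneg hD0 _)
    _ ≤ Real.exp 1 * (∫ x, |φ x| ^ (2 : ℝ) ∂μ) ^ (1 / (2 : ℝ)) := mul_le_mul_of_nonneg_right hDq hN2

/-! ## §2. Volume-free two-time decorrelation after the burn-in, `|β'| < 1/12` -/

/-- ★★★ **Volume-free time decorrelation after an `O(log L)` burn-in.**  For every `L`, `|β'| < 1/12`, every deterministic start `z`,
EVERY strong solution `U` from `z` on ANY filtered probability space, all bounded measurable `F` (`|F| ≤ 1`) and `G` (`|G| ≤ M`), and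
all lattice times `t₀, u, t ≥ 0` with `log B ≤ 2(1 − 12|β'|)·t₀` (`B = 96|β'|#E + 10|β'|#𝒫 + log 2 + #E·log(3/2)`):

  `|E[F(U_{2+t₀+u}) · (G(U_{2+t₀+u+t}) − μ_{β'}G)]| ≤ e · e^{−(1−12|β'|)t} · (∫ (G − μG)² dμ_{β'})^{1/2}`

(Markov property at `2+t₀+u`, the `L²`-warm start against `law(U₂) ≤ e^B·μ`, the volume-uniform gap on `κ_t(G − μG)`).  Rate and
prefactor are INDEPENDENT of `L`. [cite: DiaconisSaloffcoste1996, Theorem 3.7] [cite: ShenZhuZhu2022, Corollary 4.4] -/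
theorem abs_twoTime_centered_le_exp_uniform (L : ℕ) [NeZero L] (β' : ℝ) (hβ : |β'| < 1 / 12)
    (z : GaugeConfig 3 L (Matrix.specialUnitaryGroup (Fin 2) ℂ))
    {Ω : Type} [MeasurableSpace Ω] {P : Measure Ω} [IsProbabilityMeasure P]
    {W : ℝ≥0 → Ω → (Edge 3 L × NoiseIdx 2 → ℝ)} (hW : IsFlatBrownian W P)
    {U : ℝ≥0 → Ω → GaugeConfig 3 L (Matrix.specialUnitaryGroup (Fin 2) ℂ)} (hU0 : ∀ ω, U 0 ω = z)
    (hU : (latticeLangevinDynamics (fundamentalLatticeRep 2) β').IsSolution (fundamentalRep (Fin 2)) hW.natFiltration P W U)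
    {F G : GaugeConfig 3 L (Matrix.specialUnitaryGroup (Fin 2) ℂ) → ℝ} (hF : Measurable F) (hF1 : ∀ x, |F x| ≤ 1)
    (hG : Measurable G) {M : ℝ} (hGM : ∀ x, |G x| ≤ M) (t₀ u t : ℝ≥0)
    (ht₀ : Real.log (96 * |β'| * (Fintype.card (Edge 3 L) : ℝ) + 10 * |β'| * (Fintype.card (Plaquette 3 L) : ℝ) + Real.log 2 +
      (Fintype.card (Edge 3 L) : ℝ) * Real.log (3 / 2)) ≤ 2 * (1 - 12 * |β'|) * t₀) :
    |∫ ω, F (U (2 + t₀ + u) ω) * (G (U (2 + t₀ + u + t) ω) -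
        ∫ x, G x ∂(wilsonMeasure (d := 3) (L := L) (fundamentalRep (Fin 2)) β')) ∂P| ≤
      Real.exp 1 * Real.exp (-(1 - 12 * |β'|) * t) *
        (∫ x, (G x - ∫ z, G z ∂(wilsonMeasure (d := 3) (L := L) (fundamentalRep (Fin 2)) β')) ^ 2
          ∂(wilsonMeasure (d := 3) (L := L) (fundamentalRep (Fin 2)) β')) ^ (1 / (2 : ℝ)) := by
  classical
  haveI := secondCountableTopology_su2
  haveI := borelSpace_config L
  haveI : IsProbabilityMeasure (wilsonMeasure (d := 3) (L := L) (fundamentalRep (Fin 2)) β') :=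
    isProbabilityMeasure_wilsonMeasure (d := 3) (L := L) (fundamentalRep (Fin 2)) (continuous_fundamentalRep (Fin 2)) β'
  obtain ⟨κ, hκM, -, hreal⟩ := exists_transitionKernel L β'
  haveI := hκM
  set m : ℝ := ∫ x, G x ∂(wilsonMeasure (d := 3) (L := L) (fundamentalRep (Fin 2)) β') with hm
  have hmM : |m| ≤ M := abs_integral_le_of_abs_le_of_isProbabilityMeasure hGM
  -- the density bound at time `2`
  obtain ⟨hDe, hlogD⟩ := coldStart_density_constant_facts L β'
  obtain ⟨D, hDdef⟩ : ∃ D : ℝ, (Real.exp ((48 * |β'| * (Fintype.card (Edge 3 L) : ℝ)) * ((2 : ℝ≥0) : ℝ) +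
      (2 * |β'| * (Fintype.card (Plaquette 3 L) : ℝ))) * (2 * (3 / 2 : ℝ) ^ Fintype.card (Edge 3 L))) *
      (Real.exp (|β'| * (4 * (Fintype.card (Plaquette 3 L) : ℝ))) * Real.exp (|β'| * (4 * (Fintype.card (Plaquette 3 L) : ℝ)))) = D :=
    ⟨_, rfl⟩
  rw [hDdef] at hDe hlogD
  have hle₁ := map_le_smul_haar_explicit (L := L) β' (t := 2) (by norm_num) z hW hU0 hU
  obtain ⟨-, hπle⟩ := wilsonMeasure_le_smul_pi_haar_and_explicit (L := L) β'
  have hν : P.map (U 2) ≤ (ENNReal.ofReal D) • wilsonMeasure (d := 3) (L := L) (fundamentalRep (Fin 2)) β' := by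
    rw [← hDdef, ENNReal.ofReal_mul (by positivity), Measure.le_iff]
    intro A hA
    have e1 := Measure.le_iff.1 hle₁ A hA
    have e2 := Measure.le_iff.1 hπle A hA
    simp only [Measure.smul_apply, smul_eq_mul] at e1 e2 ⊢
    calc (P.map (U 2)) A ≤ _ := e1
      _ ≤ _ := mul_le_mul' le_rfl e2
      _ = _ := (mul_assoc _ _ _).symm
  haveI : IsProbabilityMeasure (P.map (U 2)) :=
    Measure.isProbabilityMeasure_map ((hU.adapted 2).mono (hW.natFiltration.le 2) le_rfl).aemeasurable
  have ht₀' : Real.log (Real.log D) ≤ 4 * ((1 - 12 * |β'|) / 2) * t₀ := by rw [hlogD]; linarith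
  -- Markov property at time `a = 2 + t₀ + u`: `E[F(U_a)(G(U_{a+t}) − m)] = E[F(U_a)·Ĝ_t(U_a)]`, `Ĝ_t = κ_tG − m`
  have hZ : Measurable[hW.natFiltration (2 + t₀ + u)] fun ω => F (U (2 + t₀ + u) ω) := hF.comp (hU.adapted (2 + t₀ + u))
  have hMark := integral_mul_comp_add_eq_integral_mul_transition β' κ hreal z hW hU0 hU (2 + t₀ + u) t hZ (fun ω => hF1 _) hG hGM
  have hκGm : Measurable fun x => ∫ y, G y ∂(κ t x) := (hG.stronglyMeasurable.integral_kernel (κ := κ t)).measurable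
  have hκGb : ∀ x, |∫ y, G y ∂(κ t x)| ≤ M := fun x => abs_integral_le_of_abs_le_of_isProbabilityMeasure (μ := κ t x) hGM
  set φ : GaugeConfig 3 L (Matrix.specialUnitaryGroup (Fin 2) ℂ) → ℝ := fun x => F x * ((∫ y, G y ∂(κ t x)) - m) with hφ
  have hφm : Measurable φ := hF.mul (hκGm.sub measurable_const)
  have hφb : ∀ x, |φ x| ≤ M + M := fun x => by
    rw [hφ, abs_mul]
    calc |F x| * |(∫ y, G y ∂(κ t x)) - m| ≤ 1 * (M + M) :=
          mul_le_mul (hF1 x) ((abs_sub _ _).trans (add_le_add (hκGb x) hmM)) (abs_nonneg _) zero_le_one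
      _ = M + M := one_mul _
  have hmU : ∀ r : ℝ≥0, Measurable (U r) := fun r => (hU.adapted r).mono (hW.natFiltration.le r) le_rfl
  have hE1 : ∫ ω, F (U (2 + t₀ + u) ω) * (G (U (2 + t₀ + u + t) ω) - m) ∂P = ∫ ω, φ (U (2 + t₀ + u) ω) ∂P := by
    have i1 : Integrable (fun ω => F (U (2 + t₀ + u) ω) * G (U (2 + t₀ + u + t) ω)) P :=
      integrable_of_abs_le P ((hF.comp (hmU _)).mul (hG.comp (hmU _))) (C := 1 * M) fun ω => by
        rw [abs_mul]; exact mul_le_mul (hF1 _) (hGM _) (abs_nonneg _) zero_le_one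
    have i2 : Integrable (fun ω => F (U (2 + t₀ + u) ω) * m) P :=
      integrable_of_abs_le P ((hF.comp (hmU _)).mul measurable_const) (C := 1 * |m|) fun ω => by
        rw [abs_mul]; exact mul_le_mul (hF1 _) le_rfl (abs_nonneg _) zero_le_one
    have i3 : Integrable (fun ω => F (U (2 + t₀ + u) ω) * ∫ y, G y ∂(κ t (U (2 + t₀ + u) ω))) P :=
      integrable_of_abs_le P ((hF.comp (hmU _)).mul (hκGm.comp (hmU _))) (C := 1 * M) fun ω => by
        rw [abs_mul]; exact mul_le_mul (hF1 _) (hκGb _) (abs_nonneg _) zero_le_one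
    have e1 : ∫ ω, F (U (2 + t₀ + u) ω) * (G (U (2 + t₀ + u + t) ω) - m) ∂P =
        (∫ ω, F (U (2 + t₀ + u) ω) * G (U (2 + t₀ + u + t) ω) ∂P) - ∫ ω, F (U (2 + t₀ + u) ω) * m ∂P := by
      rw [← integral_sub i1 i2]; exact integral_congr_ae (ae_of_all _ fun ω => by ring)
    have e2 : ∫ ω, φ (U (2 + t₀ + u) ω) ∂P =
        (∫ ω, F (U (2 + t₀ + u) ω) * ∫ y, G y ∂(κ t (U (2 + t₀ + u) ω)) ∂P) - ∫ ω, F (U (2 + t₀ + u) ω) * m ∂P := by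
      rw [← integral_sub i3 i2]; exact integral_congr_ae (ae_of_all _ fun ω => by simp only [hφ]; ring)
    rw [e1, e2, hMark]
  -- `E φ(U_{2+t₀+u}) = ∫ κ_{t₀+u} φ d law(U₂)`
  have hE2 : ∫ ω, φ (U (2 + t₀ + u) ω) ∂P = ∫ y, (∫ y', φ y' ∂(κ (t₀ + u) y)) ∂(P.map (U 2)) := by
    rw [← integral_map (hmU _).aemeasurable hφm.aestronglyMeasurable, ← hreal (2 + t₀ + u) z Ω P W hW U hU0 hU, add_assoc,
      chapmanKolmogorov_szz β' κ hreal 2 (t₀ + u), ← hreal 2 z Ω P W hW U hU0 hU]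
    haveI : IsProbabilityMeasure ((κ (t₀ + u) ∘ₖ κ 2) z) := by
      rw [← chapmanKolmogorov_szz β' κ hreal 2 (t₀ + u)]; infer_instance
    exact Kernel.integral_comp (integrable_of_abs_le _ hφm hφb)
  rw [hE1, hE2]
  -- warm start + `|φ| ≤ |Ĝ_t|` + gap
  have hρ : 0 ≤ (1 - 12 * |β'|) / 2 := by linarith
  have hwarm := abs_integral_transition_le_exp_mul_of_warm L β' κ hreal hρ
    (fun g hg => wilson_generatorLogSobolev_uniform L β' hβ g hg) hDe hν ht₀' hφm hφb u
  have hφ2 : ∫ x, |φ x| ^ (2 : ℝ) ∂(wilsonMeasure (d := 3) (L := L) (fundamentalRep (Fin 2)) β') ≤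
      ∫ x, ((∫ y, G y ∂(κ t x)) - m) ^ 2 ∂(wilsonMeasure (d := 3) (L := L) (fundamentalRep (Fin 2)) β') := by
    refine integral_mono (integrable_of_abs_le _ ((Real.continuous_rpow_const (by norm_num)).measurable.comp hφm.abs)
      (C := (M + M) ^ (2 : ℝ)) fun x => ?_) (integrable_of_abs_le _ ((hκGm.sub measurable_const).pow_const 2)
      (C := (M + M) ^ 2) fun x => ?_) fun x => ?_
    · rw [abs_of_nonneg (Real.rpow_nonneg (abs_nonneg _) _)]
      exact Real.rpow_le_rpow (abs_nonneg _) (hφb x) (by norm_num)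
    · rw [abs_pow]; exact pow_le_pow_left₀ (abs_nonneg _) ((abs_sub _ _).trans (add_le_add (hκGb x) hmM)) 2
    · simp only [hφ, Real.rpow_two]
      rw [sq_abs, mul_pow]
      have h1 : F x ^ 2 ≤ 1 := by
        have := hF1 x; rw [abs_le] at this; nlinarith
      nlinarith [sq_nonneg ((∫ y, G y ∂(κ t x)) - m)]
  have hgap := wilson_spectralGap_uniform_measurable L β' hβ κ hreal hG hGM t
  rw [← hm] at hgap
  have hchain : (∫ x, |φ x| ^ (2 : ℝ) ∂(wilsonMeasure (d := 3) (L := L) (fundamentalRep (Fin 2)) β')) ^ (1 / (2 : ℝ)) ≤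
      Real.exp (-(1 - 12 * |β'|) * t) *
        (∫ x, (G x - m) ^ 2 ∂(wilsonMeasure (d := 3) (L := L) (fundamentalRep (Fin 2)) β')) ^ (1 / (2 : ℝ)) := by
    have h := Real.rpow_le_rpow (integral_nonneg fun x => Real.rpow_nonneg (abs_nonneg _) _) (hφ2.trans hgap)
      (by norm_num : (0 : ℝ) ≤ 1 / 2)
    have e : (Real.exp (-2 * (1 - 12 * |β'|) * t) *
        ∫ x, (G x - m) ^ 2 ∂(wilsonMeasure (d := 3) (L := L) (fundamentalRep (Fin 2)) β')) ^ (1 / (2 : ℝ)) =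
        Real.exp (-(1 - 12 * |β'|) * t) *
          (∫ x, (G x - m) ^ 2 ∂(wilsonMeasure (d := 3) (L := L) (fundamentalRep (Fin 2)) β')) ^ (1 / (2 : ℝ)) := by
      rw [Real.mul_rpow (Real.exp_pos _).le (integral_nonneg fun x => sq_nonneg _)]
      congr 1
      rw [← Real.exp_mul]; congr 1; ring
    rw [e] at h; exact h
  calc _ ≤ _ := hwarm
    _ ≤ _ := by
      rw [mul_assoc]
      exact mul_le_mul_of_nonneg_left hchain (Real.exp_pos 1).le

/-! ## §3. The volume-free mean-square ergodic theorem after the burn-in -/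

/-- ★★★ **VOLUME-FREE MEAN-SQUARE ERGODIC THEOREM after an `O(log L)` burn-in, `|β'| < 1/12`.**  For every `L`, `|β'| < 1/12`, every
deterministic start `z`, EVERY jointly measurable strong solution `U` from `z` on ANY filtered probability space, every bounded measurable
`G` with `|G| ≤ 1`, every `t₀` with `log B ≤ 2(1 − 12|β'|)t₀` and every `T > 0`:

  `E[(T⁻¹ ∫_{(0,T]} G(U_{2+t₀+r}) dr − ∫ G dμ_{β'})²] ≤ 8e/((1 − 12|β'|)·T)`

— the constant `8e/(1 − 12|β'|)` does NOT depend on `L` (g33's `integral_sq_timeAverage_sub_wilson_le` has Harris constants `4C/c`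
depending on the volume); the price is the burn-in `2 + t₀ = O(log L)`.  (Variance lemma `integral_sq_timeAverage_le_of_twoTime` with the
two-time decay `abs_twoTime_centered_le_exp_uniform`.) [cite: DiaconisSaloffcoste1996, Theorem 3.7] [cite: ShenZhuZhu2022, Corollary 4.4] -/
theorem integral_sq_timeAverage_sub_wilson_le_uniform (L : ℕ) [NeZero L] (β' : ℝ) (hβ : |β'| < 1 / 12)
    (z : GaugeConfig 3 L (Matrix.specialUnitaryGroup (Fin 2) ℂ))
    {Ω : Type} [MeasurableSpace Ω] {P : Measure Ω} [IsProbabilityMeasure P]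
    {W : ℝ≥0 → Ω → (Edge 3 L × NoiseIdx 2 → ℝ)} (hW : IsFlatBrownian W P)
    {U : ℝ≥0 → Ω → GaugeConfig 3 L (Matrix.specialUnitaryGroup (Fin 2) ℂ)} (hU0 : ∀ ω, U 0 ω = z)
    (hU : (latticeLangevinDynamics (fundamentalLatticeRep 2) β').IsSolution (fundamentalRep (Fin 2)) hW.natFiltration P W U)
    (hUj : Measurable (Function.uncurry U))
    {G : GaugeConfig 3 L (Matrix.specialUnitaryGroup (Fin 2) ℂ) → ℝ} (hG : Measurable G) (hG1 : ∀ x, |G x| ≤ 1) (t₀ : ℝ≥0)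
    (ht₀ : Real.log (96 * |β'| * (Fintype.card (Edge 3 L) : ℝ) + 10 * |β'| * (Fintype.card (Plaquette 3 L) : ℝ) + Real.log 2 +
      (Fintype.card (Edge 3 L) : ℝ) * Real.log (3 / 2)) ≤ 2 * (1 - 12 * |β'|) * t₀)
    {T : ℝ} (hT : 0 < T) :
    ∫ ω, (T⁻¹ * (∫ r in Ioc 0 T, G (U (2 + t₀ + r.toNNReal) ω)) -
        ∫ x, G x ∂(wilsonMeasure (d := 3) (L := L) (fundamentalRep (Fin 2)) β')) ^ 2 ∂P ≤
      8 * Real.exp 1 / ((1 - 12 * |β'|) * T) := by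
  classical
  haveI : IsProbabilityMeasure (wilsonMeasure (d := 3) (L := L) (fundamentalRep (Fin 2)) β') :=
    isProbabilityMeasure_wilsonMeasure (d := 3) (L := L) (fundamentalRep (Fin 2)) (continuous_fundamentalRep (Fin 2)) β'
  have hlam : 0 < 1 - 12 * |β'| := by linarith
  set m : ℝ := ∫ x, G x ∂(wilsonMeasure (d := 3) (L := L) (fundamentalRep (Fin 2)) β') with hm
  have hm1 : |m| ≤ 1 := abs_integral_le_of_abs_le_of_isProbabilityMeasure hG1
  -- `(∫ (G − m)² dμ)^{1/2} ≤ 2`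
  have hV2 : (∫ x, (G x - m) ^ 2 ∂(wilsonMeasure (d := 3) (L := L) (fundamentalRep (Fin 2)) β')) ^ (1 / (2 : ℝ)) ≤ 2 := by
    have h4 : ∫ x, (G x - m) ^ 2 ∂(wilsonMeasure (d := 3) (L := L) (fundamentalRep (Fin 2)) β') ≤ 4 := by
      have hpt : ∀ x, (G x - m) ^ 2 ≤ 4 := fun x => by
        have h1 : |G x - m| ≤ 2 := (abs_sub _ _).trans (by linarith [hG1 x, hm1])
        have h2 : (G x - m) ^ 2 = |G x - m| ^ 2 := (sq_abs _).symm
        rw [h2]; nlinarith [abs_nonneg (G x - m)]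
      have := integral_mono (integrable_of_abs_le (wilsonMeasure (d := 3) (L := L) (fundamentalRep (Fin 2)) β')
        ((hG.sub measurable_const).pow_const 2) (C := 4) fun x => by
        rw [abs_of_nonneg (sq_nonneg _)]; exact hpt x)
        (integrable_const (μ := wilsonMeasure (d := 3) (L := L) (fundamentalRep (Fin 2)) β') (4 : ℝ)) hpt
      rwa [integral_const, probReal_univ, one_smul] at this
    have h := Real.rpow_le_rpow (integral_nonneg fun x => sq_nonneg _) h4 (by norm_num : (0 : ℝ) ≤ 1 / 2)
    have e : (4 : ℝ) ^ (1 / (2 : ℝ)) = 2 := by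
      rw [show (4 : ℝ) = 2 ^ (2 : ℝ) by norm_num, ← Real.rpow_mul (by norm_num)]; norm_num
    rw [e] at h; exact h
  -- the centred field `g r ω = G(U_{2+t₀+r} ω) − m`, jointly measurable, `|g| ≤ 2`
  set g : ℝ → Ω → ℝ := fun r ω => G (U (2 + t₀ + r.toNNReal) ω) - m with hgdef
  have hgm : Measurable (Function.uncurry g) := by
    have h1 : Measurable fun q : ℝ × Ω => U (2 + t₀ + q.1.toNNReal) q.2 :=
      hUj.comp (((measurable_real_toNNReal.comp measurable_fst).const_add (2 + t₀)).prodMk measurable_snd)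
    exact (hG.comp h1).sub measurable_const
  have hgb : ∀ r ω, |g r ω| ≤ 2 := fun r ω => by
    show |G (U (2 + t₀ + r.toNNReal) ω) - m| ≤ 2
    exact (abs_sub _ _).trans (by linarith [hG1 (U (2 + t₀ + r.toNNReal) ω), hm1])
  -- two-time decay, both time orders
  have hF : Measurable fun x => (G x - m) / 2 := (hG.sub measurable_const).div_const 2
  have hF1 : ∀ x, |(G x - m) / 2| ≤ 1 := fun x => by
    rw [abs_div, abs_two]
    have : |G x - m| ≤ 2 := (abs_sub _ _).trans (by linarith [hG1 x, hm1])
    linarith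
  have hord : ∀ r r' : ℝ, 0 ≤ r → r ≤ r' →
      |∫ ω, g r ω * g r' ω ∂P| ≤ 4 * Real.exp 1 * Real.exp (-(1 - 12 * |β'|) * |r' - r|) := by
    intro r r' hr hrr'
    have ht : 2 + t₀ + r'.toNNReal = 2 + t₀ + r.toNNReal + (r' - r).toNNReal := by
      rw [add_assoc (2 + t₀), ← Real.toNNReal_add hr (sub_nonneg.2 hrr')]; congr 2; ring
    have h1 := abs_twoTime_centered_le_exp_uniform L β' hβ z hW hU0 hU hF hF1 hG hG1 t₀ r.toNNReal (r' - r).toNNReal ht₀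
    rw [← ht, Real.coe_toNNReal _ (sub_nonneg.2 hrr')] at h1
    have heq : ∫ ω, g r ω * g r' ω ∂P = 2 * ∫ ω, (G (U (2 + t₀ + r.toNNReal) ω) - m) / 2 * (G (U (2 + t₀ + r'.toNNReal) ω) - m) ∂P := by
      rw [← integral_const_mul]
      exact integral_congr_ae (ae_of_all _ fun ω => by simp only [hgdef]; ring)
    rw [heq, abs_mul, abs_two, abs_of_nonneg (sub_nonneg.2 hrr')]
    have hrest : 0 ≤ Real.exp 1 * Real.exp (-(1 - 12 * |β'|) * (r' - r)) := by positivity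
    calc 2 * |∫ ω, (G (U (2 + t₀ + r.toNNReal) ω) - m) / 2 * (G (U (2 + t₀ + r'.toNNReal) ω) - m) ∂P|
        ≤ 2 * (Real.exp 1 * Real.exp (-(1 - 12 * |β'|) * (r' - r)) *
          (∫ x, (G x - m) ^ 2 ∂(wilsonMeasure (d := 3) (L := L) (fundamentalRep (Fin 2)) β')) ^ (1 / (2 : ℝ))) :=
          mul_le_mul_of_nonneg_left h1 (by norm_num)
      _ ≤ 2 * (Real.exp 1 * Real.exp (-(1 - 12 * |β'|) * (r' - r)) * 2) :=
          mul_le_mul_of_nonneg_left (mul_le_mul_of_nonneg_left hV2 hrest) (by norm_num)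
      _ = 4 * Real.exp 1 * Real.exp (-(1 - 12 * |β'|) * (r' - r)) := by ring
  have hdec : ∀ r ∈ Ioc 0 T, ∀ r' ∈ Ioc 0 T,
      |∫ ω, g r ω * g r' ω ∂P| ≤ 4 * Real.exp 1 * Real.exp (-(1 - 12 * |β'|) * |r' - r|) := by
    intro r hr r' hr'
    rcases le_total r r' with hle | hle
    · exact hord r r' hr.1.le hle
    · have hs := hord r' r hr'.1.le hle
      have hcomm : ∫ ω, g r ω * g r' ω ∂P = ∫ ω, g r' ω * g r ω ∂P := integral_congr_ae (ae_of_all _ fun ω => mul_comm _ _)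
      rw [hcomm, abs_sub_comm]
      exact hs
  -- the variance lemma
  have hvar := integral_sq_timeAverage_le_of_twoTime hgm hgb hT (by positivity : (0 : ℝ) ≤ 4 * Real.exp 1) hlam hdec
  -- `T⁻¹ ∫ G(U_{2+t₀+r}) dr − m = T⁻¹ ∫ g r dr`
  haveI : IsFiniteMeasure (volume.restrict (Ioc (0 : ℝ) T)) := isFiniteMeasure_restrict.2 measure_Ioc_lt_top.ne
  have hcent : ∀ ω, T⁻¹ * (∫ r in Ioc 0 T, G (U (2 + t₀ + r.toNNReal) ω)) - m = T⁻¹ * ∫ r in Ioc 0 T, g r ω := by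
    intro ω
    have hUr : Measurable fun r : ℝ => U (2 + t₀ + r.toNNReal) ω :=
      hUj.comp ((measurable_real_toNNReal.const_add (2 + t₀)).prodMk measurable_const)
    have hGi : Integrable (fun r : ℝ => G (U (2 + t₀ + r.toNNReal) ω)) (volume.restrict (Ioc 0 T)) :=
      (integrable_const (1 : ℝ)).mono' (hG.comp hUr).aestronglyMeasurable
        (Eventually.of_forall fun r => by simpa [Real.norm_eq_abs] using hG1 (U (2 + t₀ + r.toNNReal) ω))
    have hsub : ∫ r in Ioc 0 T, g r ω = (∫ r in Ioc 0 T, G (U (2 + t₀ + r.toNNReal) ω)) - T * m := by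
      show ∫ r in Ioc 0 T, (G (U (2 + t₀ + r.toNNReal) ω) - m) = _
      rw [integral_sub hGi (integrable_const m), integral_const, smul_eq_mul, measureReal_restrict_apply_univ,
        Real.volume_real_Ioc_of_le hT.le, sub_zero]
    rw [hsub, mul_sub, ← mul_assoc, inv_mul_cancel₀ hT.ne', one_mul]
  calc ∫ ω, (T⁻¹ * (∫ r in Ioc 0 T, G (U (2 + t₀ + r.toNNReal) ω)) - m) ^ 2 ∂P = ∫ ω, (T⁻¹ * ∫ r in Ioc 0 T, g r ω) ^ 2 ∂P :=
        integral_congr_ae (ae_of_all _ fun ω => by simp only [hcent ω])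
    _ ≤ 2 * (4 * Real.exp 1) / ((1 - 12 * |β'|) * T) := hvar
    _ = 8 * Real.exp 1 / ((1 - 12 * |β'|) * T) := by ring

end Summit.QuantumFields.YangMills.Theorems.ColdStartUniversality

end
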